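import Literature.MathematicalPhysics.QuantumLattice.SpinChainsKnabeProofs
import Literature.MathematicalPhysics.QuantumLattice.SpinChainsAkltUniqueProofs
import HarnessLib

/-!
# Coarse-grained projections on a ring: FNW's abstract gap inequality and the tiling

Sibling proof file of `Literature/MathematicalPhysics/QuantumLattice/LiebRobinson.lean`
(theorem-only: no definition, no named fact), a step towards the discharge of
`fannes_nachtergaele_werner_gap` (**hubbard.S16**; Fannes–Nachtergaele–Werner 1992, Thm. 6.4).
This file contains the two model-independent ingredients of the coarse-graining in FNW's proof of
Thm. 6.4, adapted from the open chain to a finite ring `ℤ/L`: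

* `fnw_ring_sq_sub_smul_posSemidef` — **the abstract inequality**: if `E : ℤ/N → M_n(ℂ)`
  (`N ≥ 3`) are orthogonal projections, `E_k` commutes with `E_{k+d}` for `d ∉ {0, ±1}`, and
  neighbours satisfy `E_k E_{k+1} + E_{k+1} E_k + ε' (E_k + E_{k+1}) ≥ 0` (FNW Lemma 6.3), then
  `K = Σ_k E_k` obeys `K² ≥ (1 - 2ε') K` (FNW p. 479: "`H̃² = Σ_{i,j} G̃_i^⊥ G̃_j^⊥ ≥ …`"; the
  bookkeeping `K² = Σ_d S(d)` is that of `SpinChainsKnabeProofs`).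
* `exists_ring_tiling` — **the tiling**: for `p ≥ 1` and `L ≥ 3p` the ring `ℤ/L` is cut into
  `N = ⌊L/p⌋ ≥ 3` consecutive segments of lengths in `[p, 2p)` (all of length `p` but the last, of
  length `p + (L mod p)`), with starts `c_{k+1} = c_k + len_k` and `(k, i) ↦ c_k + i` a bijection
  `Σ_k Fin (len_k) ≃ ℤ/L`; two consecutive segments are shorter than `3p`, three fit into the ring.
  (FNW coarse-grain the chain into intervals of length `m ≥ ℓ₀`; on a ring of arbitrary size one
  interval must absorb the remainder.)
* `ringBlock_add` — `{x,…,x+a+b-1} = {x,…,x+a-1} ∪ {x+a,…,x+a+b-1}`.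

## Source

* M. Fannes, B. Nachtergaele, R. F. Werner, *Finitely correlated states on quantum spin chains*,
  Comm. Math. Phys. **144** (1992) 443–490, §6, Thm. 6.4 and its proof (p. 479).
  [FannesNachtergaeleWernerCMP1992]
* S. Knabe, J. Stat. Phys. **52** (1988) 627, §2 (the resummation `H² = Σ_d S(d)`). [Knabe1988]
-/

noncomputable section

open Matrix
open scoped ComplexOrder MatrixOrder

namespace Literature.MathematicalPhysics.QuantumLattice

section QLattice

variable {q D : ℕ}

/-! ### The abstract FNW inequality on a ring of coarse-grained projections -/

/-- **FNW's Theorem 6.4, abstract core.** Let `N ≥ 3` and let `E : ℤ/N → M_n(ℂ)` be orthogonal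
projections such that `E_k` commutes with `E_{k+d}` for `d ∉ {0, 1, -1}` and neighbours satisfy
`E_k E_{k+1} + E_{k+1} E_k + ε' (E_k + E_{k+1}) ≥ 0`. Then `K = Σ_k E_k` satisfies
`K² - (1 - 2ε') K ≥ 0`. Proof (FNW p. 479): `K² = Σ_d S(d)`, `S(d) = Σ_k E_k E_{k+d}`, with
`S(0) = K`, `S(d) ≥ 0` for `d ∉ {0, ±1}` (commuting projections) and
`S(1) + S(-1) + 2ε' K = Σ_k (E_k E_{k+1} + E_{k+1} E_k + ε'(E_k + E_{k+1})) ≥ 0`.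
[cite: FannesNachtergaeleWernerCMP1992, Thm. 6.4] -/
theorem fnw_ring_sq_sub_smul_posSemidef {n : Type*} [Fintype n] [DecidableEq n] {N : ℕ} [NeZero N]
    (hN : 3 ≤ N) (E : ZMod N → Matrix n n ℂ) (hherm : ∀ k, (E k).IsHermitian)
    (hidem : ∀ k, E k * E k = E k)
    (hcomm : ∀ k d : ZMod N, d ≠ 0 → d ≠ 1 → d ≠ -1 → E k * E (k + d) = E (k + d) * E k)
    {ε' : ℝ} (hpair : ∀ k : ZMod N,
      (E k * E (k + 1) + E (k + 1) * E k + ((ε' : ℝ) : ℂ) • (E k + E (k + 1))).PosSemidef) :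
    ((∑ k, E k) * (∑ k, E k) - ((1 - 2 * ε' : ℝ) : ℂ) • ∑ k, E k).PosSemidef := by
  set K : Matrix n n ℂ := ∑ k, E k with hK
  set S : ZMod N → Matrix n n ℂ := fun d => ∑ i : ZMod N, E i * E (i + d) with hS
  have hm1 : (-1 : ZMod N) = ((N - 1 : ℕ) : ZMod N) := by
    rw [Nat.cast_sub (by omega), ZMod.natCast_self, zero_sub, Nat.cast_one]
  have d01 : (0 : ZMod N) ≠ 1 := by
    exact_mod_cast natCast_ne_natCast_zmod (N := N) (a := 0) (b := 1) (by omega) (by omega) (by omega)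
  have d0m1 : (0 : ZMod N) ≠ -1 := by
    rw [hm1]
    exact_mod_cast natCast_ne_natCast_zmod (N := N) (a := 0) (b := N - 1) (by omega) (by omega)
      (by omega)
  have d1m1 : (1 : ZMod N) ≠ -1 := by
    rw [hm1]
    exact_mod_cast natCast_ne_natCast_zmod (N := N) (a := 1) (b := N - 1) (by omega) (by omega)
      (by omega)
  have hSpos : ∀ d : ZMod N, d ≠ 0 → d ≠ 1 → d ≠ -1 → (S d).PosSemidef := fun d hd0 hd1 hdm1 =>
    posSemidef_sum _ fun i _ =>
      posSemidef_mul_of_commute (hherm i) (hidem i) (hherm _) (hidem _) (hcomm i d hd0 hd1 hdm1)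
  have hsq : K * K = ∑ d, S d := sum_mul_sum_eq_sum_sum_shift E
  have hS0 : S 0 = K := by simp only [hS, hK, add_zero, hidem]
  have hSm1 : S (-1) = ∑ k, E (k + 1) * E k := by
    simp only [hS]
    rw [← Equiv.sum_comp (Equiv.addRight (1 : ZMod N))]
    simp
  have hsum3 : ∑ d ∈ ({0, 1, -1} : Finset (ZMod N)), S d = S 0 + S 1 + S (-1) := by
    rw [Finset.sum_insert, Finset.sum_pair d1m1]
    · abel
    · simp only [Finset.mem_insert, Finset.mem_singleton, not_or]; exact ⟨d01, d0m1⟩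
  set T : Finset (ZMod N) := Finset.univ \ {0, 1, -1} with hT
  have hsplit : ∑ d, S d = S 0 + S 1 + S (-1) + ∑ d ∈ T, S d := by
    rw [← Finset.sum_sdiff (Finset.subset_univ ({0, 1, -1} : Finset (ZMod N))), hsum3, add_comm]
  have hTpos : (∑ d ∈ T, S d).PosSemidef := by
    refine posSemidef_sum _ fun d hd => ?_
    simp only [hT, Finset.mem_sdiff, Finset.mem_univ, true_and, Finset.mem_insert,
      Finset.mem_singleton, not_or] at hd
    exact hSpos d hd.1 hd.2.1 hd.2.2
  have hpairsum : ∑ k, (E k * E (k + 1) + E (k + 1) * E k + ((ε' : ℝ) : ℂ) • (E k + E (k + 1))) =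
      S 1 + S (-1) + ((2 * ε' : ℝ) : ℂ) • K := by
    simp only [Finset.sum_add_distrib, smul_add, ← Finset.smul_sum, hSm1, hK,
      sum_shift (fun k => E k) 1]
    push_cast
    module
  have hid : K * K - ((1 - 2 * ε' : ℝ) : ℂ) • K =
      ∑ k, (E k * E (k + 1) + E (k + 1) * E k + ((ε' : ℝ) : ℂ) • (E k + E (k + 1))) +
        ∑ d ∈ T, S d := by
    rw [hpairsum, hsq, hsplit, hS0]
    push_cast
    module
  rw [hid]
  exact (posSemidef_sum _ fun k _ => hpair k).add hTpos

/-! ### Tiling the ring by segments -/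

/-- Splitting a ring block in two: `{x,…,x+a+b-1} = {x,…,x+a-1} ∪ {x+a,…,x+a+b-1}`. [folklore] -/
theorem ringBlock_add (L a b : ℕ) (x : ZMod L) :
    ringBlock L (a + b) x = ringBlock L a x ∪ ringBlock L b (x + ((a : ℕ) : ZMod L)) := by
  ext y
  simp only [Finset.mem_union, mem_ringBlock_iff]
  constructor
  · rintro ⟨i, rfl⟩
    by_cases hi : (i : ℕ) < a
    · exact Or.inl ⟨⟨i, hi⟩, rfl⟩
    · refine Or.inr ⟨⟨i - a, by omega⟩, ?_⟩
      show x + ((i : ℕ) : ZMod L) = x + (a : ZMod L) + (((i : ℕ) - a : ℕ) : ZMod L)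
      rw [Nat.cast_sub (by omega)]
      ring
  · rintro (⟨i, rfl⟩ | ⟨i, rfl⟩)
    · exact ⟨⟨i, by omega⟩, rfl⟩
    · exact ⟨⟨a + i, by omega⟩, by push_cast; ring⟩

/-- **Tiling a ring by segments.** For `p ≥ 1` and `L ≥ 3p`, the ring `ℤ/L` is cut into
`N = ⌊L/p⌋ ≥ 3` consecutive segments, `N - 1` of length `p` and one of length `p + (L mod p) < 2p`:
segment `k : ℤ/N` starts at `c_k`, has length `len_k`, `c_{k+1} = c_k + len_k`, and
`(k, i) ↦ c_k + i` (`i < len_k`) is a bijection onto `ℤ/L`. (The coarse-graining used in FNW's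
proof of Thm. 6.4, adapted to a finite ring.) [folklore] -/
theorem exists_ring_tiling {p : ℕ} (hp : 0 < p) (L : ℕ) [NeZero L] (hL : 3 * p ≤ L) :
    ∃ (N : ℕ) (_ : NeZero N), 3 ≤ N ∧ ∃ (c : ZMod N → ZMod L) (len : ZMod N → ℕ),
      (∀ k, c (k + 1) = c k + ((len k : ℕ) : ZMod L)) ∧
      (∀ k, p ≤ len k) ∧
      (∀ k, len k + len (k + 1) < 3 * p) ∧
      (∀ k, len k + len (k + 1) + len (k + 1 + 1) ≤ L) ∧
      Function.Bijective
        (fun ki : (Σ k : ZMod N, Fin (len k)) => c ki.1 + (((ki.2 : ℕ) : ℕ) : ZMod L)) := by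
  -- `N = ⌊L/p⌋ = M + 1`, `r = L mod p`, `L = M p + p + r`
  set N : ℕ := L / p with hNdef
  set r : ℕ := L % p with hrdef
  have hN3 : 3 ≤ N := (Nat.le_div_iff_mul_le hp).2 hL
  have hr : r < p := Nat.mod_lt L hp
  obtain ⟨M, hM⟩ : ∃ M, N = M + 1 := ⟨N - 1, by omega⟩
  have hLdec : L = M * p + p + r := by
    have h := Nat.div_add_mod' L p
    rw [← hNdef, ← hrdef, hM, add_mul, one_mul] at h
    omega
  haveI : NeZero N := ⟨by omega⟩
  haveI : Fact (1 < N) := ⟨by omega⟩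
  -- the segments
  set len : ZMod N → ℕ := fun k => if k.val = M then p + r else p with hlen
  set c : ZMod N → ZMod L := fun k => (((k.val * p : ℕ)) : ZMod L) with hc
  have hval1 : ∀ k : ZMod N, (k + 1).val = if k.val = M then 0 else k.val + 1 := by
    intro k
    have hk := ZMod.val_lt k
    rw [ZMod.val_add, ZMod.val_one]
    split_ifs with h
    · rw [h, ← hM, Nat.mod_self]
    · exact Nat.mod_eq_of_lt (by omega)
  have hlenle : ∀ k, len k ≤ p + r := fun k => by simp only [hlen]; split_ifs <;> omega
  have hlenge : ∀ k, p ≤ len k := fun k => by simp only [hlen]; split_ifs <;> omega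
  have hlen1 : ∀ k : ZMod N, k.val = M → len (k + 1) = p := by
    intro k hk
    have h1 : (k + 1).val = 0 := by rw [hval1, if_pos hk]
    simp only [hlen, h1]
    rw [if_neg (by omega)]
  refine ⟨N, inferInstance, hN3, c, len, fun k => ?_, hlenge, fun k => ?_, fun k => ?_, ?_, ?_⟩
  · -- `c (k+1) = c k + len k`
    simp only [hc, hlen, hval1 k]
    split_ifs with h
    · rw [h, zero_mul, Nat.cast_zero, ← Nat.cast_add, show M * p + (p + r) = L by omega,
        ZMod.natCast_self]
    · push_cast
      ring
  · -- two consecutive segments are shorter than `3p`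
    by_cases hk : k.val = M
    · have h0 : len k = p + r := by simp only [hlen, if_pos hk]
      have h1 : len (k + 1) = p := hlen1 k hk
      omega
    · have h0 : len k = p := by simp only [hlen, if_neg hk]
      have h1 : len (k + 1) ≤ p + r := hlenle (k + 1)
      omega
  · -- three consecutive segments fit into the ring (`L ≥ 3p + r`)
    have hMp : 2 * p ≤ M * p := Nat.mul_le_mul_right p (by omega)
    have hL3 : 3 * p + r ≤ L := by omega
    have hsum : len k + len (k + 1) + len (k + 1 + 1) ≤ 3 * p + r := by
      by_cases hk : k.val = M
      · have h0 : len k = p + r := by simp only [hlen, if_pos hk]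
        have hv1 : (k + 1).val = 0 := by rw [hval1, if_pos hk]
        have h1 : len (k + 1) = p := by
          simp only [hlen, hv1]
          rw [if_neg (by omega)]
        have hv2 : (k + 1 + 1).val = 1 := by rw [hval1 (k + 1), hv1, if_neg (by omega)]
        have h2 : len (k + 1 + 1) = p := by
          simp only [hlen, hv2]
          rw [if_neg (by omega)]
        omega
      · have h0 : len k = p := by simp only [hlen, if_neg hk]
        by_cases hk1 : (k + 1).val = M
        · have h1 : len (k + 1) = p + r := by simp only [hlen, if_pos hk1]
          have h2 : len (k + 1 + 1) = p := hlen1 (k + 1) hk1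
          omega
        · have h1 : len (k + 1) = p := by simp only [hlen, if_neg hk1]
          have h2 : len (k + 1 + 1) ≤ p + r := hlenle _
          omega
    omega
  · -- injectivity
    rintro ⟨k, i⟩ ⟨k', i'⟩ h
    simp only at h
    have hbound : ∀ (k : ZMod N) (i : Fin (len k)), k.val * p + (i : ℕ) < L := by
      intro k i
      have hi := i.2
      simp only [hlen] at hi
      have hk := ZMod.val_lt k
      split_ifs at hi with hkM
      · rw [hkM] at *; omega
      · have h1 : (k.val + 1) * p ≤ M * p := Nat.mul_le_mul_right p (by omega)
        rw [add_one_mul] at h1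
        omega
    have hnat : k.val * p + (i : ℕ) = k'.val * p + (i' : ℕ) := by
      have h' : (((k.val * p + (i : ℕ) : ℕ)) : ZMod L) = (((k'.val * p + (i' : ℕ) : ℕ)) : ZMod L) := by
        simp only [hc] at h
        push_cast at h ⊢
        exact h
      rw [ZMod.natCast_eq_natCast_iff', Nat.mod_eq_of_lt (hbound k i),
        Nat.mod_eq_of_lt (hbound k' i')] at h'
      exact h'
    have hi := i.2
    have hi' := i'.2
    simp only [hlen] at hi hi'
    have hkk : k.val = k'.val := by
      split_ifs at hi hi' with hkM hkM' hkM'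
      · rw [hkM, hkM']
      · exfalso
        have h1 : (k'.val + 1) * p ≤ M * p :=
          Nat.mul_le_mul_right p (by have := ZMod.val_lt k'; omega)
        rw [add_one_mul] at h1
        rw [hkM] at hnat
        omega
      · exfalso
        have h1 : (k.val + 1) * p ≤ M * p :=
          Nat.mul_le_mul_right p (by have := ZMod.val_lt k; omega)
        rw [add_one_mul] at h1
        rw [hkM'] at hnat
        omega
      · have e1 : ((i : ℕ) + k.val * p) / p = k.val := by
          rw [Nat.add_mul_div_right _ _ hp, Nat.div_eq_of_lt hi, zero_add]
        have e2 : ((i' : ℕ) + k'.val * p) / p = k'.val := by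
          rw [Nat.add_mul_div_right _ _ hp, Nat.div_eq_of_lt hi', zero_add]
        rw [← e1, ← e2, add_comm, hnat, add_comm]
    obtain rfl : k = k' := ZMod.val_injective N hkk
    have hii : (i : ℕ) = (i' : ℕ) := by omega
    exact Sigma.ext rfl (heq_of_eq (Fin.ext hii))
  · -- surjectivity
    intro x
    have hx := ZMod.val_lt x
    by_cases hlt : x.val < M * p
    · -- a short segment
      have hkM : x.val / p < M := (Nat.div_lt_iff_lt_mul hp).2 hlt
      have hkval : ((x.val / p : ℕ) : ZMod N).val = x.val / p := by
        rw [ZMod.val_natCast, Nat.mod_eq_of_lt (by omega)]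
      have hlenk : len ((x.val / p : ℕ) : ZMod N) = p := by
        simp only [hlen, hkval]
        rw [if_neg (by omega)]
      refine ⟨⟨((x.val / p : ℕ) : ZMod N), ⟨x.val % p, by rw [hlenk]; exact Nat.mod_lt _ hp⟩⟩, ?_⟩
      simp only [hc, hkval]
      rw [← Nat.cast_add, Nat.div_add_mod' x.val p, ZMod.natCast_zmod_val]
    · -- the last (long) segment
      have hkval : ((M : ℕ) : ZMod N).val = M := by
        rw [ZMod.val_natCast, Nat.mod_eq_of_lt (by omega)]
      have hlenk : len ((M : ℕ) : ZMod N) = p + r := by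
        simp [hlen, hkval]
      refine ⟨⟨((M : ℕ) : ZMod N), ⟨x.val - M * p, by rw [hlenk]; omega⟩⟩, ?_⟩
      simp only [hc, hkval]
      rw [← Nat.cast_add, show M * p + (x.val - M * p) = x.val by omega, ZMod.natCast_zmod_val]

end QLattice

end Literature.MathematicalPhysics.QuantumLattice
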